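import Mathlib
import HarnessLib
import Literature.Probability.MarkovChains.SpectralGapVariational

/-!
# Simple comparison of reversible chains: `𝓔̃ ≤ α𝓔 ⇒ γ̃ ≤ [max π/π̃]·α·γ` (Levin–Peres–Wilmer Lemma 13.18, Remark 13.19)

HONEST FRAMING: exact (Metropolis-corrected) sampling algorithms for lattice gauge theory; figures
of merit are autocorrelation/cost numbers at stated couplings and volumes; no continuum-physics claim.

Conventions of `PeskunOrdering.lean` (`dirichletForm π P f = 𝓔(f)`, `piInner`), `DistinguishingStatistic.lean`
(`lawMean`, `lawVariance` = `E_π`, `Var_π`), `SpectralGapTestFunction.lean` (Remark 13.8 test-function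
bound), `CheegerInequality.lean` (`piInner_sub_const_eq`: `m ↦ E_π(f − m)²` is minimised at `E_π f`) and
`SpectralGapVariational.lean` (`spectralGap π P = γ = 1 − λ₂`, Lemma 13.7, `exists_eigenfunction_spectralGap`).
Source: D. A. Levin, Y. Peres (with E. L. Wilmer), *Markov Chains and Mixing Times*, 2nd ed., AMS 2017
[LevinPeres2017], §13.3.  Everything is PROVED (0 named facts).  Setting: two row-stochastic
transition matrices `P`, `P̃` on the same finite `X` (`|X| ≥ 2`), reversible with respect to positive
probability vectors `π`, `π̃`.

* `lawVariance_le_mul_lawVariance` — **eq. (13.12)**: `Var_π(f) ≤ c(π,π̃)·Var_π̃(f)` whenever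
  `π ≤ c·π̃` pointwise (the book's `c(π,π̃) = max_x π(x)/π̃(x)`; any dominating constant works)
  [cite: LevinPeres2017, §13.3 Lemma 13.18 (proof, eq. (13.12))];
* **LEMMA 13.18** `LevinPeres2017_lemma_13_18` — if `𝓔̃(f) ≤ α𝓔(f)` for all `f` and `π ≤ c·π̃`, then
  **`γ̃ ≤ c·α·γ`** — eq. (13.11) with `[max_x π(x)/π̃(x)]` generalised to any constant `c` dominating
  `π/π̃`; `LevinPeres2017_lemma_13_18_max` is the printed form with `c = max_x π(x)/π̃(x)`
  [cite: LevinPeres2017, §13.3 Lemma 13.18 eq. (13.11)].  Proof as printed (the minimising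
  eigenfunction `g` of `γ` from Lemma 13.7 as the test function in Remark 13.8 for `P̃`, and (13.12));
* **REMARK 13.19** `LevinPeres2017_remark_13_19` — if `P̃(x,y) ≤ βP(x,y)` off the diagonal and
  `π̃ ≤ c'·π` (with `π̃, P̃ ≥ 0`), then `𝓔̃(f) ≤ β·c'·𝓔(f)`, so Lemma 13.18 applies
  [cite: LevinPeres2017, §13.3 Remark 13.19].

Context (cell pub-lqcd): comparison of Dirichlet forms is the mechanism of `PeskunOrdering.lean`
(asymptotic variances) and of `spectralGapR_mono`; this file adds the printed two-measure version for
the spectral gap `γ`.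
-/

namespace Literature.Probability.MarkovChains

open Finset Matrix

variable {X : Type*} [Fintype X] [DecidableEq X]

omit [DecidableEq X] in
/-- **Eq. (13.12)**: if `π(x) ≤ c·π̃(x)` for all `x` then `Var_π(f) ≤ c·Var_π̃(f)` — "`m ↦ E_π(f − m)²`
is minimized at `m = E_π(f)` … the right-hand side is bounded by `c(π,π̃) Σ [f(x) − E_π̃(f)]² π̃(x)`".
For a probability vector `π`. [cite: LevinPeres2017, §13.3 Lemma 13.18 (proof, eq. (13.12))] -/
theorem lawVariance_le_mul_lawVariance {π πt : X → ℝ} (hπ1 : ∑ x, π x = 1)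
    {c : ℝ} (hc : ∀ x, π x ≤ c * πt x) (f : X → ℝ) :
    lawVariance π f ≤ c * lawVariance πt f := by
  -- `Var_π(f) ≤ E_π(f − E_π̃ f)² = Σ π (f − m̃)²`
  set mt := lawMean πt f with hmt
  have h1 : lawVariance π f ≤ piInner π (fun x => f x - mt) (fun x => f x - mt) := by
    rw [piInner_sub_const_eq hπ1 f mt]
    nlinarith [sq_nonneg (lawMean π f - mt)]
  -- `Σ π (f − m̃)² ≤ c Σ π̃ (f − m̃)² = c Var_π̃(f)`
  have h2 : piInner π (fun x => f x - mt) (fun x => f x - mt) ≤ c * lawVariance πt f := by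
    unfold piInner lawVariance
    rw [mul_sum]
    refine sum_le_sum fun x _ => ?_
    rw [← hmt, ← sq]
    calc π x * (f x - mt) ^ 2 ≤ c * πt x * (f x - mt) ^ 2 :=
          mul_le_mul_of_nonneg_right (hc x) (sq_nonneg _)
      _ = c * (πt x * (f x - mt) ^ 2) := by ring
  exact h1.trans h2

omit [DecidableEq X] in
/-- **Lemma 13.18 (simple comparison).**  Let `P`, `P̃` be reversible with respect to the positive
probability vectors `π`, `π̃` on a finite `X` with `|X| ≥ 2`.  If `𝓔̃(f) ≤ α𝓔(f)` for all `f` and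
`π(x) ≤ c·π̃(x)` for all `x`, then **`γ̃ ≤ c·α·γ`** (eq. (13.11), where the book takes
`c = max_x π(x)/π̃(x)`). [cite: LevinPeres2017, §13.3 Lemma 13.18 eq. (13.11)] -/
theorem LevinPeres2017_lemma_13_18 [Nontrivial X] {π πt : X → ℝ} (hπ : ∀ x, 0 < π x)
    (hπ1 : ∑ x, π x = 1) (hπt : ∀ x, 0 < πt x) (hπt1 : ∑ x, πt x = 1) {P Pt : Matrix X X ℝ}
    (hP : IsRowStochastic P) (hDB : DetailedBalance π P) (hPt : IsRowStochastic Pt)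
    (hDBt : DetailedBalance πt Pt) {α : ℝ}
    (hα : ∀ f : X → ℝ, dirichletForm πt Pt f ≤ α * dirichletForm π P f) {c : ℝ}
    (hc : ∀ x, π x ≤ c * πt x) :
    spectralGap πt Pt ≤ c * α * spectralGap π P := by
  have hπt0 : ∀ x, 0 ≤ πt x := fun x => (hπt x).le
  -- the eigenfunction `g` realising `γ`: `g ⊥_π 1`, `‖g‖_π = 1`, `𝓔(g) = γ`
  obtain ⟨g, hg0, hg1, hEg, -⟩ := exists_eigenfunction_spectralGap hπ hπ1 hP hDB
  have hmean : lawMean π g = 0 := hg0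
  have hVar : lawVariance π g = 1 := by
    unfold lawVariance
    rw [hmean]
    unfold piInner at hg1
    rw [← hg1]
    exact sum_congr rfl fun x _ => by ring
  -- `c > 0` (some `π(x) > 0` is dominated by `c π̃(x)`)
  obtain ⟨x₀⟩ : Nonempty X := inferInstance
  have hcpos : 0 < c := by
    have h := hc x₀
    by_contra hcn
    push Not at hcn
    have : c * πt x₀ ≤ 0 := mul_nonpos_of_nonpos_of_nonneg hcn (hπt0 x₀)
    linarith [hπ x₀]
  -- (13.12) for `g`: `1 = Var_π(g) ≤ c Var_π̃(g)`, so `Var_π̃(g) > 0`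
  have h12 := lawVariance_le_mul_lawVariance hπ1 hc g
  rw [hVar] at h12
  have hVt : 0 < lawVariance πt g := by
    by_contra h
    push Not at h
    have : c * lawVariance πt g ≤ 0 := mul_nonpos_of_nonneg_of_nonpos hcpos.le h
    linarith
  -- Remark 13.8 for `P̃` with the test function `g`, and Lemma 13.7 for `P̃`
  have h1 : spectralGap πt Pt ≤ dirichletForm πt Pt g / lawVariance πt g := by
    rw [LevinPeres2017_lemma_13_7 hπt hπt1 hPt hDBt]
    exact spectralGapR_le_dirichletForm_div_lawVariance hπt0 hπt1 hPt.1 hVt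
  -- `𝓔̃(g) ≤ α𝓔(g) = αγ` and `1/Var_π̃(g) ≤ c`
  have hE0 : 0 ≤ α * dirichletForm π P g :=
    (dirichletForm_nonneg hπt0 hPt.1 g).trans (hα g)
  calc spectralGap πt Pt ≤ dirichletForm πt Pt g / lawVariance πt g := h1
    _ ≤ α * dirichletForm π P g / lawVariance πt g :=
        div_le_div_of_nonneg_right (hα g) hVt.le
    _ ≤ α * dirichletForm π P g * c := by
        rw [div_le_iff₀ hVt]
        calc α * dirichletForm π P g = α * dirichletForm π P g * 1 := by ring
          _ ≤ α * dirichletForm π P g * (c * lawVariance πt g) :=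
              mul_le_mul_of_nonneg_left h12 hE0
          _ = α * dirichletForm π P g * c * lawVariance πt g := by ring
    _ = c * α * spectralGap π P := by rw [hEg]; ring

omit [DecidableEq X] in
/-- **Lemma 13.18 as printed**, with `c(π,π̃) = max_x π(x)/π̃(x)` (written `⨆ x, π x / π̃ x`, the
maximum over the finite `X`): `γ̃ ≤ [max_x π(x)/π̃(x)]·α·γ`.
[cite: LevinPeres2017, §13.3 Lemma 13.18 eq. (13.11)] -/
theorem LevinPeres2017_lemma_13_18_max [Nontrivial X] {π πt : X → ℝ} (hπ : ∀ x, 0 < π x)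
    (hπ1 : ∑ x, π x = 1) (hπt : ∀ x, 0 < πt x) (hπt1 : ∑ x, πt x = 1) {P Pt : Matrix X X ℝ}
    (hP : IsRowStochastic P) (hDB : DetailedBalance π P) (hPt : IsRowStochastic Pt)
    (hDBt : DetailedBalance πt Pt) {α : ℝ}
    (hα : ∀ f : X → ℝ, dirichletForm πt Pt f ≤ α * dirichletForm π P f) :
    spectralGap πt Pt ≤ (⨆ x, π x / πt x) * α * spectralGap π P := by
  refine LevinPeres2017_lemma_13_18 hπ hπ1 hπt hπt1 hP hDB hPt hDBt hα fun x => ?_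
  have hle : π x / πt x ≤ ⨆ y, π y / πt y :=
    le_ciSup (f := fun y => π y / πt y) (Set.finite_range _).bddAbove x
  calc π x = π x / πt x * πt x := by rw [div_mul_cancel₀ _ (hπt x).ne']
    _ ≤ (⨆ y, π y / πt y) * πt x := mul_le_mul_of_nonneg_right hle (hπt x).le

omit [DecidableEq X] in
/-- **Remark 13.19**: if `P̃(x,y) ≤ βP(x,y)` for `x ≠ y` and `π̃(x) ≤ c'π(x)` for all `x` (`π̃ ≥ 0`,
`P̃ ≥ 0`), then `𝓔̃(f) ≤ β·c'·𝓔(f)` for every `f` ("`𝓔̃(f) ≤ βc(π̃,π)𝓔(f)`, and Lemma 13.18 can be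
applied"; the diagonal terms of `𝓔` vanish, so only the off-diagonal order is needed).
[cite: LevinPeres2017, §13.3 Remark 13.19] -/
theorem LevinPeres2017_remark_13_19 {π πt : X → ℝ} (hπt0 : ∀ x, 0 ≤ πt x) {P Pt : Matrix X X ℝ}
    (hPt0 : ∀ x y, 0 ≤ Pt x y) {β c' : ℝ} (hPle : ∀ x y, x ≠ y → Pt x y ≤ β * P x y)
    (hπle : ∀ x, πt x ≤ c' * π x) (f : X → ℝ) :
    dirichletForm πt Pt f ≤ β * c' * dirichletForm π P f := by
  have key : ∑ x, ∑ y, πt x * Pt x y * (f x - f y) ^ 2 ≤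
      β * c' * ∑ x, ∑ y, π x * P x y * (f x - f y) ^ 2 := by
    rw [mul_sum]
    refine sum_le_sum fun x _ => ?_
    rw [mul_sum]
    refine sum_le_sum fun y _ => ?_
    by_cases hxy : x = y
    · subst hxy; simp
    · have hcπ : 0 ≤ c' * π x := (hπt0 x).trans (hπle x)
      calc πt x * Pt x y * (f x - f y) ^ 2 ≤ (c' * π x) * (β * P x y) * (f x - f y) ^ 2 :=
            mul_le_mul_of_nonneg_right (mul_le_mul (hπle x) (hPle x y hxy) (hPt0 x y) hcπ)
              (sq_nonneg _)
        _ = β * c' * (π x * P x y * (f x - f y) ^ 2) := by ring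
  unfold dirichletForm
  calc (1 / 2 : ℝ) * ∑ x, ∑ y, πt x * Pt x y * (f x - f y) ^ 2
      ≤ (1 / 2) * (β * c' * ∑ x, ∑ y, π x * P x y * (f x - f y) ^ 2) :=
        mul_le_mul_of_nonneg_left key (by norm_num)
    _ = β * c' * ((1 / 2) * ∑ x, ∑ y, π x * P x y * (f x - f y) ^ 2) := by ring

end Literature.Probability.MarkovChains
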